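import Literature.NumberTheory.Rogawski1990.TamagawaSingularMembersLetter          -- ★ p833072: the S1′ letter `TamagawaSingularMembersExist` — the (K7-s) vocabulary
import Literature.NumberTheory.Automorphic.OrbitalMeasureQuotientOfPointHaarChange  -- ★ `quotientMeasure_nnreal_smul_haar`, `isInvInvariant_nnreal_smul` (+ ★ `quotientMeasure_eq_inv_smul_of_eq_smul`)
import Literature.NumberTheory.Automorphic.UnitaryGroupCovolWeightStable          -- ★ `countable_quotientSubgroup_inf_centralizer_subgroupOf` (the rational centraliser lattice is countable)
import HarnessLib

/-!
# (K7-s) TRANSPORT ALONG A CONSTANT ARCHIMEDEAN RATIO: the Tamagawa covolume identity for the singular members is invariant under replacing the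
# archimedean member by a constant multiple on the non-central singular classes (Rogawski 1990 §14.5 p. 239; §1.7 p. 6)

Topic `NumberTheory/Rogawski1990`; namespace `Literature.NumberTheory.Rogawski1990`.  THEOREMS ONLY (no `def`, no instance, no notation, no axiom, no named
fact, no `sorry`).  Cell `pub/hodgecm-mathlib`, ENGINE T1 (crux H413 = `stmt-HodgeConjecture-24833`); the `stub_S1` (S1′ = books #88) road, brick (W6)
(F0P3a-p07 (g10); LEAD F0P3a-plan (g10) T9-19 (2) ∕ T9-22 (3): «(J-val-K) is the ONE named hypothesis of the (K7-s) assembly; (W4d) EXPORTS (W-a) for the D-T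
(K7-s) assembly»).  Count-neutral; HONEST LABEL: HC_CM is proved only modulo the printed citations until rung 0 closes.

WHAT.  The (K7-s) conjunct of ★ `TamagawaSingularMembersExist` («for centraliser Haar data `νZ c` that are the Weil-quotient partners of the built adelic
orbital family `ofLocal mGs mGis` against the adelic Haar measure `νA` at the non-regular classes, the covolumes of the rational centralisers of STABLY
CONJUGATE singular classes agree», print: «`m(Z G′_{γ^δ}∖G′_{γ^δ}) = m(Z_H∖H)` for every `δ`», [Rogawski1990 §14.5 p. 239] via [Kottwitz1988 Prop. 2]) reads
the archimedean member `mGis` ONLY through `ofLocal`, which is HOMOGENEOUS of degree one in the archimedean point measure (§1).  Hence (§3): if two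
archimedean families satisfy `m₁.atPoint (γ_c)_∞ = K • m₂.atPoint (γ_c)_∞` (`K ≠ 0`) at every non-regular NON-CENTRAL rational class `c` — the shape of the
(W-a) export of the (ST-∞) witness road («the built singular member is `K •` the differential-top-form member», ★ `ArchSingularPinTopFormRatio` §2) — then
the VERBATIM (K7-s) text for `(mGs, m₁)` follows from the same text for `(mGs, m₂)` guarded by «non-regular ∧ non-central» on BOTH classes: the Weil
partners rescale by `K` (★ `quotientMeasure_eq_inv_smul_of_eq_smul`), the covolumes rescale by the same `K` (★ `quotientMeasure_nnreal_smul_haar`), and the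
central classes are STABLY RIGID (§2: a class stably conjugate to a central class IS that class, since stable conjugacy is conjugacy in `GL₃(L)`,
★ `IsStablyConj`), so the central instances of (K7-s) are reflexive.  Everything is Mathlib + ★; no new definition.

* §1 `orbitalMeasureOfProd_nnreal_smul_left`, `adelicOrbitalMeasureOfLocal_nnreal_smul_arch`, `ofLocal_eq_nnreal_smul_of_atPoint_eq` — homogeneity in the
  archimedean factor (unconditional: `Measure.prod_def` + `Measure.bind_smul` + `Measure.map_smul`, no s-finiteness).
* §2 `conjClasses_eq_of_stableClass_eq_of_central` — stable rigidity of the central classes of `U(H′)(L)`.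
* §3 **`tamagawaSingularCovolume_transport_of_atPoint_eq_smul`** — the (K7-s) transport.

## References
* [Rogawski1990] J. D. Rogawski, *Automorphic Representations of Unitary Groups in Three Variables*, Ann. of Math. Stud. 123 (1990), §1.7 p. 6, p. 11; §3.1 p. 19;
  §5.4 p. 72; §14.5 Lemma 14.5.2 (b) pp. 238–239.
* [Kottwitz1988] R. E. Kottwitz, *Tamagawa numbers*, Ann. of Math. 127 (1988), Thm. 1, Prop. 2.
* [DeitmarEchterhoff2014] A. Deitmar, S. Echterhoff, *Principles of Harmonic Analysis*, 2nd ed. (2014), Thm. 1.5.3.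
* [Gelbart1975] S. Gelbart, *Automorphic forms on adele groups* (1975), p. 155 (10.19).
-/

set_option autoImplicit false

noncomputable section

open MeasureTheory Measure NumberField IsDedekindDomain
open Literature.MeasureTheory.Group Literature.NumberTheory.Automorphic
open Literature.AlgebraicGeometry.ShimuraVarieties (unitaryGroup hermForm)
open scoped Matrix MatrixGroups NNReal ENNReal

namespace Literature.NumberTheory.Rogawski1990

/-! ## §1 Homogeneity of the built adelic orbital measure in the archimedean factor -/

section Homogeneity

/-- **`(K • μ₁) ⊠ μ₂ = K • (μ₁ ⊠ μ₂)`** for ★ `orbitalMeasureOfProd` (unconditional: `Measure.prod` is `bind`, and `bind`, `map` are homogeneous).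
[cite: Gelbart1975, p. 155 (10.19)] -/
theorem orbitalMeasureOfProd_nnreal_smul_left {G₁ G₂ G : Type*} [Group G₁] [Group G₂] [Group G]
    [TopologicalSpace G₁] [TopologicalSpace G₂] [IsTopologicalGroup G₁] [IsTopologicalGroup G₂]
    (e : G₁ × G₂ ≃* G) {γ : G} {γ₁ : G₁} {γ₂ : G₂} (hγ : e (γ₁, γ₂) = γ)
    {_ : MeasurableSpace (G ⧸ Subgroup.centralizer ({γ} : Set G))}
    {_ : MeasurableSpace (G₁ ⧸ Subgroup.centralizer ({γ₁} : Set G₁))}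
    {_ : MeasurableSpace (G₂ ⧸ Subgroup.centralizer ({γ₂} : Set G₂))}
    (μ₁ : Measure (G₁ ⧸ Subgroup.centralizer ({γ₁} : Set G₁)))
    (μ₂ : Measure (G₂ ⧸ Subgroup.centralizer ({γ₂} : Set G₂))) (K : ℝ≥0) :
    orbitalMeasureOfProd e hγ (K • μ₁) μ₂ = K • orbitalMeasureOfProd e hγ μ₁ μ₂ := by
  unfold orbitalMeasureOfProd
  rw [Measure.prod_def, Measure.prod_def, Measure.bind_smul, Measure.map_smul, Measure.map_smul]

variable (L : Type) [Field L] [NumberField L] [IsCMField L] (N : ℕ) (H : Matrix (Fin N) (Fin N) L)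

/-- **`adelicOrbitalMeasureOfLocal` is homogeneous in the archimedean factor**: `μ(g; K • ma, m) = K • μ(g; ma, m)`. [cite: Rogawski1990, §5.4 p. 72] -/
theorem adelicOrbitalMeasureOfLocal_nnreal_smul_arch (g : (UnitaryGroup.cmDatum L N H).Adelic)
    {_ : MeasurableSpace ((UnitaryGroup.cmDatum L N H).Adelic ⧸ Subgroup.centralizer ({g} : Set (UnitaryGroup.cmDatum L N H).Adelic))}
    {_ : MeasurableSpace (UnitaryGroup.arch (↥(maximalRealSubfield L)) L (IsCMField.complexConj L) N H ⧸
      Subgroup.centralizer ({UnitaryGroup.archPart (↥(maximalRealSubfield L)) L (IsCMField.complexConj L) N H g} :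
        Set (UnitaryGroup.arch (↥(maximalRealSubfield L)) L (IsCMField.complexConj L) N H)))}
    {_ : MeasurableSpace (UnitaryGroup.finAdelic (↥(maximalRealSubfield L)) L (IsCMField.complexConj L) N H ⧸
      Subgroup.centralizer ({(UnitaryGroup.finPart (↥(maximalRealSubfield L)) L (IsCMField.complexConj L) N H g)} :
        Set (UnitaryGroup.finAdelic (↥(maximalRealSubfield L)) L (IsCMField.complexConj L) N H)))}
    {_ : ∀ v, MeasurableSpace ((UnitaryGroup.cmDatum L N H).Local v ⧸
      Subgroup.centralizer ({((UnitaryGroup.cmDatum L N H).toLocal v g)} : Set ((UnitaryGroup.cmDatum L N H).Local v)))}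
    (ma : Measure (UnitaryGroup.arch (↥(maximalRealSubfield L)) L (IsCMField.complexConj L) N H ⧸
      Subgroup.centralizer ({UnitaryGroup.archPart (↥(maximalRealSubfield L)) L (IsCMField.complexConj L) N H g} :
        Set (UnitaryGroup.arch (↥(maximalRealSubfield L)) L (IsCMField.complexConj L) N H))))
    (m : ∀ v, Measure ((UnitaryGroup.cmDatum L N H).Local v ⧸
      Subgroup.centralizer ({((UnitaryGroup.cmDatum L N H).toLocal v g)} : Set ((UnitaryGroup.cmDatum L N H).Local v))))
    (S₀ : Finset (HeightOneSpectrum (𝓞 ↥(maximalRealSubfield L)))) (K : ℝ≥0) :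
    UnitaryGroup.adelicOrbitalMeasureOfLocal L N H g (K • ma) m S₀ = K • UnitaryGroup.adelicOrbitalMeasureOfLocal L N H g ma m S₀ :=
  orbitalMeasureOfProd_nnreal_smul_left _ _ _ _ K

variable
  [∀ g : (UnitaryGroup.cmDatum L N H).Adelic, MeasurableSpace ((UnitaryGroup.cmDatum L N H).Adelic ⧸ Subgroup.centralizer ({g} : Set (UnitaryGroup.cmDatum L N H).Adelic))]
  [∀ a : UnitaryGroup.arch (↥(maximalRealSubfield L)) L (IsCMField.complexConj L) N H,
    MeasurableSpace (UnitaryGroup.arch (↥(maximalRealSubfield L)) L (IsCMField.complexConj L) N H ⧸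
      Subgroup.centralizer ({a} : Set (UnitaryGroup.arch (↥(maximalRealSubfield L)) L (IsCMField.complexConj L) N H)))]
  [∀ (v : HeightOneSpectrum (𝓞 ↥(maximalRealSubfield L))) (x : (UnitaryGroup.cmDatum L N H).Local v),
    MeasurableSpace ((UnitaryGroup.cmDatum L N H).Local v ⧸ Subgroup.centralizer ({x} : Set ((UnitaryGroup.cmDatum L N H).Local v)))]
  (mG : ∀ v : HeightOneSpectrum (𝓞 ↥(maximalRealSubfield L)), OrbitalMeasureFamily ((UnitaryGroup.cmDatum L N H).Local v))
  (m₁ m₂ : OrbitalMeasureFamily (UnitaryGroup.arch (↥(maximalRealSubfield L)) L (IsCMField.complexConj L) N H))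
  (c : ConjClasses (UnitaryGroup.cmDatum L N H).Rational)

/-- **`ofLocal` is homogeneous in the archimedean member at the class**: if `m₁.atPoint (γ_c)_∞ = K • m₂.atPoint (γ_c)_∞` (`γ_c = out c`), then
`ofLocal mG m₁ c = K • ofLocal mG m₂ c` (both branches of the definition: the exceptional-set condition reads `mG` only). [cite: Rogawski1990, §5.4 p. 72] -/
theorem ofLocal_eq_nnreal_smul_of_atPoint_eq (K : ℝ≥0)
    (h : m₁.atPoint (UnitaryGroup.archPart (↥(maximalRealSubfield L)) L (IsCMField.complexConj L) N H ((UnitaryGroup.cmDatum L N H).toAdelic (Quotient.out c))) =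
      K • m₂.atPoint (UnitaryGroup.archPart (↥(maximalRealSubfield L)) L (IsCMField.complexConj L) N H ((UnitaryGroup.cmDatum L N H).toAdelic (Quotient.out c)))) :
    UnitaryGroup.AdelicOrbitalMeasureFamily.ofLocal L N H mG m₁ c = K • UnitaryGroup.AdelicOrbitalMeasureFamily.ofLocal L N H mG m₂ c := by
  unfold UnitaryGroup.AdelicOrbitalMeasureFamily.ofLocal
  by_cases hS : ∃ S₀, UnitaryGroup.IsNormalisedOff L N H mG ((UnitaryGroup.cmDatum L N H).toAdelic (Quotient.out c)) S₀
  · rw [dif_pos hS, dif_pos hS, h]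
    exact adelicOrbitalMeasureOfLocal_nnreal_smul_arch L N H _ _ _ _ K
  · rw [dif_neg hS, dif_neg hS, smul_zero]

end Homogeneity

/-! ## §2 Stable rigidity of the central classes -/

section Rigidity

variable (L : Type) [Field L] [NumberField L] [IsCMField L] (H' : Matrix (Fin 3) (Fin 3) L)

/-- The representatives of two conjugacy classes of `U(H′)(L)` with the same stable class are stably conjugate (= conjugate in `GL₃(L)`).
[cite: Rogawski1990, §3.1 p. 19] -/
theorem isStablyConj_out_of_stableClass_eq (c c' : ConjClasses ↥(unitaryGroup (cmConjRingHom L) H'))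
    (hst : StableClass.ofConjClass c = StableClass.ofConjClass c') :
    IsStablyConj (cmConjRingHom L) H' (Quotient.out c) (Quotient.out c') := by
  have hc : ConjClasses.mk (Quotient.out c) = c := Quotient.out_eq c
  have hc' : ConjClasses.mk (Quotient.out c') = c' := Quotient.out_eq c'
  rw [← hc, ← hc'] at hst
  change stableClassOf (cmConjRingHom L) H' (Quotient.out c) = stableClassOf (cmConjRingHom L) H' (Quotient.out c') at hst
  exact stableClassOf_eq_iff.mp hst

/-- A class of `U(H′)(L)` stably conjugate to a CENTRAL class is that class (`ζ•1` is `GL₃(L)`-conjugate only to itself). [cite: Rogawski1990, §3.1 p. 19] -/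
theorem conjClasses_eq_of_stableClass_eq_of_central' (c c' : ConjClasses ↥(unitaryGroup (cmConjRingHom L) H'))
    (hcen : ∃ ζ : L, (((Quotient.out c).val : GL (Fin 3) L) : Matrix (Fin 3) (Fin 3) L) = ζ • (1 : Matrix (Fin 3) (Fin 3) L))
    (hst : StableClass.ofConjClass c = StableClass.ofConjClass c') : c = c' := by
  obtain ⟨ζ, hζ⟩ := hcen
  obtain ⟨g, hg⟩ := isStablyConj_iff.mp (isStablyConj_out_of_stableClass_eq L H' c c' hst)
  -- `g (ζ•1) g⁻¹ = ζ•1`, so `out c'` and `out c` have the same matrix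
  have hmat : (((Quotient.out c').val : GL (Fin 3) L) : Matrix (Fin 3) (Fin 3) L) = (((Quotient.out c).val : GL (Fin 3) L) : Matrix (Fin 3) (Fin 3) L) := by
    have h1 := congrArg (fun u : GL (Fin 3) L => (u : Matrix (Fin 3) (Fin 3) L)) hg
    simp only [Units.val_mul] at h1
    rw [← h1, hζ, Matrix.mul_smul, Matrix.mul_one, Matrix.smul_mul, Units.mul_inv]
  have hval : ((Quotient.out c').val : GL (Fin 3) L) = ((Quotient.out c).val : GL (Fin 3) L) := Units.ext hmat
  have hout : Quotient.out c' = Quotient.out c := Subtype.ext hval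
  have hc : ConjClasses.mk (Quotient.out c) = c := Quotient.out_eq c
  have hc' : ConjClasses.mk (Quotient.out c') = c' := Quotient.out_eq c'
  rw [← hc, ← hc', hout]

/-- Regularity is a stable-class invariant of the representatives (★ `isRegularElt_of_isConj`). [cite: Rogawski1990, §3.1 p. 19] -/
theorem not_isRegularElt_out_of_stableClass_eq (c c' : ConjClasses (UnitaryGroup.cmDatum L 3 H').Rational)
    (hst : StableClass.ofConjClass c = StableClass.ofConjClass c') (hreg : ¬ IsRegularElt ((Quotient.out c).val : GL (Fin 3) L)) :
    ¬ IsRegularElt ((Quotient.out c').val : GL (Fin 3) L) :=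
  fun h' => hreg (isRegularElt_of_isConj (isStablyConj_out_of_stableClass_eq L H' c c' hst).symm h')

/-- **A class stably conjugate to a CENTRAL class is that class** (on the `cmDatum` carrier): stable conjugacy in `U(H′)(L)` is conjugacy in `GL₃(L)`
(★ `IsStablyConj`), and `ζ•1` is `GL₃(L)`-conjugate only to itself. [cite: Rogawski1990, §3.1 p. 19] -/
theorem conjClasses_eq_of_stableClass_eq_of_central (c c' : ConjClasses (UnitaryGroup.cmDatum L 3 H').Rational)
    (hcen : ∃ ζ : L, (((Quotient.out c).val : GL (Fin 3) L) : Matrix (Fin 3) (Fin 3) L) = ζ • (1 : Matrix (Fin 3) (Fin 3) L))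
    (hst : StableClass.ofConjClass c = StableClass.ofConjClass c') : c = c' :=
  conjClasses_eq_of_stableClass_eq_of_central' L H' c c' hcen hst

end Rigidity

/-! ## §3 The (K7-s) transport -/

section Transport

variable (L : Type) [Field L] [NumberField L] [IsCMField L] (H' : Matrix (Fin 3) (Fin 3) L)
    [∀ g : (UnitaryGroup.cmDatum L 3 H').Adelic, MeasurableSpace ((UnitaryGroup.cmDatum L 3 H').Adelic ⧸ Subgroup.centralizer ({g} : Set (UnitaryGroup.cmDatum L 3 H').Adelic))]
    [∀ g : (UnitaryGroup.cmDatum L 3 H').Adelic, BorelSpace ((UnitaryGroup.cmDatum L 3 H').Adelic ⧸ Subgroup.centralizer ({g} : Set (UnitaryGroup.cmDatum L 3 H').Adelic))]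
    [∀ γ : UnitaryGroup.arch (↥(maximalRealSubfield L)) L (IsCMField.complexConj L) 3 H',
      MeasurableSpace (UnitaryGroup.arch (↥(maximalRealSubfield L)) L (IsCMField.complexConj L) 3 H' ⧸ Subgroup.centralizer ({γ} : Set (UnitaryGroup.arch (↥(maximalRealSubfield L)) L (IsCMField.complexConj L) 3 H')))]
    [∀ (v : HeightOneSpectrum (𝓞 ↥(maximalRealSubfield L))) (γ : (UnitaryGroup.cmDatum L 3 H').Local v),
      MeasurableSpace ((UnitaryGroup.cmDatum L 3 H').Local v ⧸ Subgroup.centralizer ({γ} : Set ((UnitaryGroup.cmDatum L 3 H').Local v)))]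
    [MeasurableSpace (UnitaryGroup.cmDatum L 3 H').Adelic] [BorelSpace (UnitaryGroup.cmDatum L 3 H').Adelic]
    [∀ γ : (UnitaryGroup.cmDatum L 3 H').Adelic, MeasurableSpace (↥(Subgroup.centralizer ({γ} : Set (UnitaryGroup.cmDatum L 3 H').Adelic)) ⧸
      ((UnitaryGroup.cmDatum L 3 H').quotientSubgroup ⊓ Subgroup.centralizer ({γ} : Set (UnitaryGroup.cmDatum L 3 H').Adelic)).subgroupOf (Subgroup.centralizer ({γ} : Set (UnitaryGroup.cmDatum L 3 H').Adelic)))]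
    [∀ γ : (UnitaryGroup.cmDatum L 3 H').Adelic, BorelSpace (↥(Subgroup.centralizer ({γ} : Set (UnitaryGroup.cmDatum L 3 H').Adelic)) ⧸
      ((UnitaryGroup.cmDatum L 3 H').quotientSubgroup ⊓ Subgroup.centralizer ({γ} : Set (UnitaryGroup.cmDatum L 3 H').Adelic)).subgroupOf (Subgroup.centralizer ({γ} : Set (UnitaryGroup.cmDatum L 3 H').Adelic)))]
    [hCcl : ∀ γ : (UnitaryGroup.cmDatum L 3 H').Adelic, IsClosed ((Subgroup.centralizer ({γ} : Set (UnitaryGroup.cmDatum L 3 H').Adelic) : Subgroup (UnitaryGroup.cmDatum L 3 H').Adelic) : Set (UnitaryGroup.cmDatum L 3 H').Adelic)]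
    [∀ γ : (UnitaryGroup.cmDatum L 3 H').Adelic, (count : Measure ↥(((UnitaryGroup.cmDatum L 3 H').quotientSubgroup ⊓ Subgroup.centralizer ({γ} : Set (UnitaryGroup.cmDatum L 3 H').Adelic)).subgroupOf
      (Subgroup.centralizer ({γ} : Set (UnitaryGroup.cmDatum L 3 H').Adelic)))).IsHaarMeasure]
    (νA : Measure (UnitaryGroup.cmDatum L 3 H').Adelic) [νA.IsHaarMeasure] [νA.IsMulRightInvariant]
    (mGs : ∀ v : HeightOneSpectrum (𝓞 ↥(maximalRealSubfield L)), OrbitalMeasureFamily ((UnitaryGroup.cmDatum L 3 H').Local v))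
    (m₁ m₂ : OrbitalMeasureFamily (UnitaryGroup.arch (↥(maximalRealSubfield L)) L (IsCMField.complexConj L) 3 H'))

set_option maxHeartbeats 400000 in
/-- **(K7-s) TRANSPORT ALONG A CONSTANT ARCHIMEDEAN RATIO.**  Let `mGs` be finite local class-indexed orbital families of `U(H′)`, `m₁, m₂` two archimedean
ones, and `K ≠ 0` with `m₁.atPoint (γ_c)_∞ = K • m₂.atPoint (γ_c)_∞` at every non-regular NON-CENTRAL rational class `c` (`γ_c = out c`; hypothesis `hK`).  IF the
(K7-s) text holds for `(mGs, m₂)` in the guarded form `hTF` — for all centraliser Haar data `νZ` (Haar, right- and inversion-invariant at every class) with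
`ofLocal mGs m₂ c = dνA ∕ dνZ c` at the non-regular non-central classes, the covolumes `vol(Z_c(L⁺)∖Z_c(𝔸); νZ c)` of stably conjugate non-regular non-central
`c, c′` agree — THEN the (K7-s) conjunct of ★ `TamagawaSingularMembersExist` holds VERBATIM for `(mGs, m₁)`.  Proof: for `νZ` as in (K7-s) for `m₁`, the data
`νZ′ c := K • νZ c` satisfy `hTF`'s antecedent (`ofLocal mGs m₂ c = K⁻¹ • ofLocal mGs m₁ c = K⁻¹ • dνA ∕ dνZ c = dνA ∕ d(K • νZ c)`, §1 + ★
`quotientMeasure_eq_inv_smul_of_eq_smul`), so their covolumes agree, and `vol(·; K • νZ c) = K · vol(·; νZ c)` (★ `quotientMeasure_nnreal_smul_haar`) with `K ≠ 0`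
finite; a pair with a central member is `c = c′` by §2 (stable rigidity); regularity and centrality are stable-class invariants (★ `isRegularElt_of_isConj`, §2).
This is the junction «(K7-s) for the BUILT (ST-∞) witness ⟸ (K7-s) for the differential-top-form member under it» of the `stub_S1` road: print's covolume
identity [Rogawski1990 §14.5 p. 239: `m(Z G′_{γ^δ}∖G′_{γ^δ}) = m(Z_H∖H)`; Kottwitz1988 Prop. 2] is insensitive to a COMMON rescaling of the archimedean members of
one stable class, which is all the (ST-∞) witness differs from the top-form witness by ((W-a), ★ `ArchSingularPinTopFormRatio`).
[cite: Rogawski1990, §14.5 Lemma 14.5.2 (b) p. 239; §1.7 p. 6] [cite: Kottwitz1988, Prop. 2] [cite: DeitmarEchterhoff2014, Thm. 1.5.3] -/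
theorem tamagawaSingularCovolume_transport_of_atPoint_eq_smul (K : ℝ≥0) (hK0 : K ≠ 0)
    (hK : ∀ c : ConjClasses (UnitaryGroup.cmDatum L 3 H').Rational, ¬ IsRegularElt ((Quotient.out c).val : GL (Fin 3) L) →
      (¬ ∃ ζ : L, (((Quotient.out c).val : GL (Fin 3) L) : Matrix (Fin 3) (Fin 3) L) = ζ • (1 : Matrix (Fin 3) (Fin 3) L)) →
      m₁.atPoint (UnitaryGroup.archPart (↥(maximalRealSubfield L)) L (IsCMField.complexConj L) 3 H' ((UnitaryGroup.cmDatum L 3 H').toAdelic (Quotient.out c))) =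
        K • m₂.atPoint (UnitaryGroup.archPart (↥(maximalRealSubfield L)) L (IsCMField.complexConj L) 3 H' ((UnitaryGroup.cmDatum L 3 H').toAdelic (Quotient.out c))))
    (hTF : ∀ (νZ : ∀ c : ConjClasses (UnitaryGroup.cmDatum L 3 H').Rational,
          Measure ↥(Subgroup.centralizer ({(UnitaryGroup.cmDatum L 3 H').toAdelic (Quotient.out c)} : Set (UnitaryGroup.cmDatum L 3 H').Adelic)))
        (_ : ∀ c, IsHaarMeasure (νZ c)) (_ : ∀ c, (νZ c).IsMulRightInvariant) (_ : ∀ c, (νZ c).IsInvInvariant),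
        (∀ c, ¬ IsRegularElt ((Quotient.out c).val : GL (Fin 3) L) →
          (¬ ∃ ζ : L, (((Quotient.out c).val : GL (Fin 3) L) : Matrix (Fin 3) (Fin 3) L) = ζ • (1 : Matrix (Fin 3) (Fin 3) L)) →
          UnitaryGroup.AdelicOrbitalMeasureFamily.ofLocal L 3 H' mGs m₂ c =
            quotientMeasure (Subgroup.centralizer ({(UnitaryGroup.cmDatum L 3 H').toAdelic (Quotient.out c)} : Set (UnitaryGroup.cmDatum L 3 H').Adelic)) (νZ c) (hCcl _) νA) →
        ∀ c c' : ConjClasses (UnitaryGroup.cmDatum L 3 H').Rational, ¬ IsRegularElt ((Quotient.out c).val : GL (Fin 3) L) →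
          (¬ ∃ ζ : L, (((Quotient.out c).val : GL (Fin 3) L) : Matrix (Fin 3) (Fin 3) L) = ζ • (1 : Matrix (Fin 3) (Fin 3) L)) →
          ¬ IsRegularElt ((Quotient.out c').val : GL (Fin 3) L) →
          (¬ ∃ ζ : L, (((Quotient.out c').val : GL (Fin 3) L) : Matrix (Fin 3) (Fin 3) L) = ζ • (1 : Matrix (Fin 3) (Fin 3) L)) →
          StableClass.ofConjClass c = StableClass.ofConjClass c' →
          quotientMeasure (((UnitaryGroup.cmDatum L 3 H').quotientSubgroup ⊓
                Subgroup.centralizer ({(UnitaryGroup.cmDatum L 3 H').toAdelic (Quotient.out c)} : Set (UnitaryGroup.cmDatum L 3 H').Adelic)).subgroupOf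
                (Subgroup.centralizer ({(UnitaryGroup.cmDatum L 3 H').toAdelic (Quotient.out c)} : Set (UnitaryGroup.cmDatum L 3 H').Adelic))) count
                (isClosed_subgroupOf _ _ ((UnitaryGroup.isClosed_cmDatum_quotientSubgroup L 3 H').inter (hCcl _))) (νZ c) Set.univ =
            quotientMeasure (((UnitaryGroup.cmDatum L 3 H').quotientSubgroup ⊓
                Subgroup.centralizer ({(UnitaryGroup.cmDatum L 3 H').toAdelic (Quotient.out c')} : Set (UnitaryGroup.cmDatum L 3 H').Adelic)).subgroupOf
                (Subgroup.centralizer ({(UnitaryGroup.cmDatum L 3 H').toAdelic (Quotient.out c')} : Set (UnitaryGroup.cmDatum L 3 H').Adelic))) count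
                (isClosed_subgroupOf _ _ ((UnitaryGroup.isClosed_cmDatum_quotientSubgroup L 3 H').inter (hCcl _))) (νZ c') Set.univ) :
    -- (K7-s) VERBATIM (★ `TamagawaSingularMembersExist`, `mGis := m₁`)
    ∀ (νZ : ∀ c : ConjClasses (UnitaryGroup.cmDatum L 3 H').Rational,
          Measure ↥(Subgroup.centralizer ({(UnitaryGroup.cmDatum L 3 H').toAdelic (Quotient.out c)} : Set (UnitaryGroup.cmDatum L 3 H').Adelic)))
        (_ : ∀ c, IsHaarMeasure (νZ c)) (_ : ∀ c, (νZ c).IsMulRightInvariant) (_ : ∀ c, (νZ c).IsInvInvariant),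
        (∀ c, ¬ IsRegularElt ((Quotient.out c).val : GL (Fin 3) L) →
          UnitaryGroup.AdelicOrbitalMeasureFamily.ofLocal L 3 H' mGs m₁ c =
            quotientMeasure (Subgroup.centralizer ({(UnitaryGroup.cmDatum L 3 H').toAdelic (Quotient.out c)} : Set (UnitaryGroup.cmDatum L 3 H').Adelic)) (νZ c) (hCcl _) νA) →
        ∀ c c' : ConjClasses (UnitaryGroup.cmDatum L 3 H').Rational, ¬ IsRegularElt ((Quotient.out c).val : GL (Fin 3) L) →
          StableClass.ofConjClass c = StableClass.ofConjClass c' →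
          quotientMeasure (((UnitaryGroup.cmDatum L 3 H').quotientSubgroup ⊓
                Subgroup.centralizer ({(UnitaryGroup.cmDatum L 3 H').toAdelic (Quotient.out c)} : Set (UnitaryGroup.cmDatum L 3 H').Adelic)).subgroupOf
                (Subgroup.centralizer ({(UnitaryGroup.cmDatum L 3 H').toAdelic (Quotient.out c)} : Set (UnitaryGroup.cmDatum L 3 H').Adelic))) count
                (isClosed_subgroupOf _ _ ((UnitaryGroup.isClosed_cmDatum_quotientSubgroup L 3 H').inter (hCcl _))) (νZ c) Set.univ =
            quotientMeasure (((UnitaryGroup.cmDatum L 3 H').quotientSubgroup ⊓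
                Subgroup.centralizer ({(UnitaryGroup.cmDatum L 3 H').toAdelic (Quotient.out c')} : Set (UnitaryGroup.cmDatum L 3 H').Adelic)).subgroupOf
                (Subgroup.centralizer ({(UnitaryGroup.cmDatum L 3 H').toAdelic (Quotient.out c')} : Set (UnitaryGroup.cmDatum L 3 H').Adelic))) count
                (isClosed_subgroupOf _ _ ((UnitaryGroup.isClosed_cmDatum_quotientSubgroup L 3 H').inter (hCcl _))) (νZ c') Set.univ := by
  intro νZ hH hR hI hq c c' hreg hst
  -- a pair with a central member is a diagonal pair
  by_cases hcen : ∃ ζ : L, (((Quotient.out c).val : GL (Fin 3) L) : Matrix (Fin 3) (Fin 3) L) = ζ • (1 : Matrix (Fin 3) (Fin 3) L)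
  · cases conjClasses_eq_of_stableClass_eq_of_central L H' c c' hcen hst
    rfl
  by_cases hcen' : ∃ ζ : L, (((Quotient.out c').val : GL (Fin 3) L) : Matrix (Fin 3) (Fin 3) L) = ζ • (1 : Matrix (Fin 3) (Fin 3) L)
  · cases conjClasses_eq_of_stableClass_eq_of_central L H' c' c hcen' hst.symm
    rfl
  -- regularity is a stable-class invariant
  have hreg' : ¬ IsRegularElt ((Quotient.out c').val : GL (Fin 3) L) := not_isRegularElt_out_of_stableClass_eq L H' c c' hst hreg
  -- the rescaled centraliser data `K • νZ`
  haveI hH' : ∀ d, IsHaarMeasure ((K • νZ d : Measure _)) := fun d => IsHaarMeasure.nnreal_smul (νZ d) hK0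
  haveI hR' : ∀ d, ((K • νZ d : Measure _)).IsMulRightInvariant := fun d => inferInstance
  haveI hI' : ∀ d, ((K • νZ d : Measure _)).IsInvInvariant := fun d => isInvInvariant_nnreal_smul (νZ d) K
  have hq' : ∀ d : ConjClasses (UnitaryGroup.cmDatum L 3 H').Rational, ¬ IsRegularElt ((Quotient.out d).val : GL (Fin 3) L) →
      (¬ ∃ ζ : L, (((Quotient.out d).val : GL (Fin 3) L) : Matrix (Fin 3) (Fin 3) L) = ζ • (1 : Matrix (Fin 3) (Fin 3) L)) →
      UnitaryGroup.AdelicOrbitalMeasureFamily.ofLocal L 3 H' mGs m₂ d =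
        quotientMeasure (Subgroup.centralizer ({(UnitaryGroup.cmDatum L 3 H').toAdelic (Quotient.out d)} : Set (UnitaryGroup.cmDatum L 3 H').Adelic))
          (K • νZ d) (hCcl _) νA := by
    intro d hdreg hdcen
    have h1 := hq d hdreg
    have h2 := ofLocal_eq_nnreal_smul_of_atPoint_eq L 3 H' mGs m₁ m₂ d K (hK d hdreg hdcen)
    rw [quotientMeasure_eq_inv_smul_of_eq_smul (hH := hCcl _) (Subgroup.centralizer ({(UnitaryGroup.cmDatum L 3 H').toAdelic (Quotient.out d)} :
        Set (UnitaryGroup.cmDatum L 3 H').Adelic)) νA (νZ d) (K • νZ d) K hK0 rfl, ← h1, h2, smul_smul, inv_mul_cancel₀ hK0, one_smul]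
  have key := hTF (fun d => K • νZ d) hH' hR' hI' hq' c c' hreg hcen hreg' hcen' hst
  -- the rational centraliser lattices are countable, so `count` on them is s-finite
  haveI := UnitaryGroup.countable_quotientSubgroup_inf_centralizer_subgroupOf L 3 H' ((UnitaryGroup.cmDatum L 3 H').toAdelic (Quotient.out c))
  haveI := UnitaryGroup.countable_quotientSubgroup_inf_centralizer_subgroupOf L 3 H' ((UnitaryGroup.cmDatum L 3 H').toAdelic (Quotient.out c'))
  rw [quotientMeasure_nnreal_smul_haar (hZ := isClosed_subgroupOf _ _ ((UnitaryGroup.isClosed_cmDatum_quotientSubgroup L 3 H').inter (hCcl _)))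
      (((UnitaryGroup.cmDatum L 3 H').quotientSubgroup ⊓ Subgroup.centralizer ({(UnitaryGroup.cmDatum L 3 H').toAdelic (Quotient.out c)} : Set (UnitaryGroup.cmDatum L 3 H').Adelic)).subgroupOf (Subgroup.centralizer ({(UnitaryGroup.cmDatum L 3 H').toAdelic (Quotient.out c)} : Set (UnitaryGroup.cmDatum L 3 H').Adelic))) count (νZ c) K hK0,
    quotientMeasure_nnreal_smul_haar (hZ := isClosed_subgroupOf _ _ ((UnitaryGroup.isClosed_cmDatum_quotientSubgroup L 3 H').inter (hCcl _)))
      (((UnitaryGroup.cmDatum L 3 H').quotientSubgroup ⊓ Subgroup.centralizer ({(UnitaryGroup.cmDatum L 3 H').toAdelic (Quotient.out c')} : Set (UnitaryGroup.cmDatum L 3 H').Adelic)).subgroupOf (Subgroup.centralizer ({(UnitaryGroup.cmDatum L 3 H').toAdelic (Quotient.out c')} : Set (UnitaryGroup.cmDatum L 3 H').Adelic))) count (νZ c') K hK0,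
    Measure.smul_apply, Measure.smul_apply, ENNReal.smul_def, ENNReal.smul_def] at key
  exact (ENNReal.mul_right_inj (ENNReal.coe_ne_zero.2 hK0) ENNReal.coe_ne_top).1 key

end Transport

end Literature.NumberTheory.Rogawski1990

end
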